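import Summits.Ventures.YMGap.RobustBall.StarKernelSusceptibilityBall
import Summits.Ventures.YMGap.RobustBall.OneStateBoundary
import Summits.Ventures.YMGap.RobustBall.BoundaryDecayTorus
import Mathlib.Analysis.Normed.Group.Tannery
import HarnessLib

/-!
# Venture YMGap, track DS / Y2 ROBUST-BALL (seat ds-3) — «C-KMIX-STAR» on the gauge-invariant tier-1 `ℤ⁴` ball, step 4: for EVERY member
# of `MemBallZdG (3/125) (3/250) R` and every `0 ≤ β_W ≤ 1/3`, the box susceptibility with ARBITRARY boundary fields converges to the
# member's infinite-volume susceptibility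

HONEST FRAMING. WHAT THIS IS: a venture file (cell `pub-ymgap`, seat ds-3; one theorem, no `def`, no named fact): the ball twin of
`StarKernelSusceptibilityLimit.lean`. Ingredients, all in the tree or in this seat's chain: ds-2's row `su2_massGapOnBallZdG_star_upTo_oneThird`
(`PerturbedMassGapAt` for every member, unique DLR state), the seat's `boundaryLimit_of_perturbedMassGapAt` (every finite-volume Gibbs
distribution of the member converges to its DLR state on bounded continuous observables, uniformly in the boundary field), the uniform box
majorant `StarKernelSusceptibilityBall.su2_abs_cov_plaquette_kernel_box_ball_upTo_oneThird`, and Tannery's theorem: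
* ★★ `su2_kernel_susceptibility_star_ball_tendsto_upTo_oneThird` — for every member `(W, supp)`, EVERY sequence of boundary fields `η_M` and
  every plaquette `p`: `Σ_{q based in box M} cov_{γ^W_{box M}(·|η_M)}(W_p, W_q) ⟶ Σ_q cov_{μ_W}(W_p, W_q)` (absolutely summable), `μ_W` the
  member's unique DLR state — the thermodynamic limit of the susceptibility exists, is finite and boundary-condition independent, UNIFORMLY IN
  THE SENSE OF HOLDING FOR EVERY MEMBER of the ball.
WHAT THIS IS NOT: no rate; lattice strong coupling; nothing about the continuum limit or the Clay problem.

References: Mathlib `tendsto_tsum_of_dominated_convergence`; B. Simon (1993) §II.12, §III.2; the seat's `StarKernelSusceptibilityBall.lean`,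
`OneStateBoundary.lean`; ds-2's `MassGapOnBallZdGRows.lean`.
-/

noncomputable section

open MeasureTheory ProbabilityTheory Function Finset Real Filter
open scoped NNReal Topology
open Literature.Probability.LatticeModels
open Literature.Probability.LatticeModels.DobrushinMetric (IsLipBound)
open Literature.MathematicalPhysics.QuantumLattice hiding torusNorm
open Literature.MathematicalPhysics.QuantumFieldTheory hiding ZdEdge
open Summit.Ventures.YMGap.DSWindowZd
open Summit.Ventures.YMGap.StarResolventDim (gaugeR)

namespace Summit.Ventures.YMGap.RobustBall

/-- ★★ **`SU(2)`, `d = 4`, EVERY `0 ≤ β_W ≤ 1/3`, EVERY MEMBER OF THE GAUGE-INVARIANT TIER-1 BALL `MemBallZdG (3/125) (3/250) R`: THE BOX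
SUSCEPTIBILITY WITH ARBITRARY BOUNDARY FIELDS CONVERGES TO THE MEMBER'S INFINITE-VOLUME SUSCEPTIBILITY.** The member's DLR states at tree
coupling `2·(β_W/4)` form a singleton `{μ}`, and for EVERY sequence of boundary fields `η_M` and every plaquette `p`: the row `q ↦ cov_μ(W_p, W_q)` is
summable and `Σ_{q based in box M} cov_{γ^W_{box M}(·|η_M)}(W_p, W_q) → Σ_q cov_μ(W_p, W_q)`. [folklore] -/
theorem su2_kernel_susceptibility_star_ball_tendsto_upTo_oneThird {βW : ℝ} (h0 : 0 ≤ βW) (h : βW ≤ 1 / 3) {R : ℕ}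
    {W : Potential (ZdEdge 4) (SUN 2)} {supp : Finset (ZdEdge 4) → Finset (Finset (ZdEdge 4))}
    (hW : MemBallZdG (3 / 125) (3 / 250) R W supp) :
    ∃ μ : Measure (LGConfig 4 (SUN 2)),
      perturbedGibbsMeasures (d := 4) (fundamentalRep (Fin 2)) ((2 : ℕ) * (βW / 4)) W supp = {μ} ∧
      ∀ (ηs : ℕ → LGConfig 4 (SUN 2)) (p : ZdPlaquette 4),
        (Summable fun q : ZdPlaquette 4 =>
            cov[zdPlaquetteObs (fundamentalRep (Fin 2)) p.1 p.2.1.1 p.2.1.2,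
              zdPlaquetteObs (fundamentalRep (Fin 2)) q.1 q.2.1.1 q.2.1.2; μ]) ∧
        Tendsto (fun M : ℕ => ∑ q ∈ (box 4 M) ×ˢ (Finset.univ : Finset {o : Fin 4 × Fin 4 // o.1 < o.2}),
            cov[zdPlaquetteObs (fundamentalRep (Fin 2)) p.1 p.2.1.1 p.2.1.2,
              zdPlaquetteObs (fundamentalRep (Fin 2)) q.1 q.2.1.1 q.2.1.2;
              perturbedYM (d := 4) (fundamentalRep (Fin 2)) ((2 : ℕ) * (βW / 4)) W supp
                ((box 4 M) ×ˢ (Finset.univ : Finset (Fin 4))) (ηs M)]) atTop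
          (𝓝 (∑' q : ZdPlaquette 4, cov[zdPlaquetteObs (fundamentalRep (Fin 2)) p.1 p.2.1.1 p.2.1.2,
              zdPlaquetteObs (fundamentalRep (Fin 2)) q.1 q.2.1.1 q.2.1.2; μ])) := by
  classical
  -- the member's unique state and its boundary-limit theorem
  have hgap : PerturbedMassGapAt 4 2 (βW / 4) W supp := su2_massGapOnBallZdG_star_upTo_oneThird h0 h R W supp hW
  obtain ⟨μ, hG, hlim⟩ := boundaryLimit_of_perturbedMassGapAt hgap hW.continuous hW.dependsOn hW.supportedBy
  have hμ : μ ∈ perturbedGibbsMeasures (d := 4) (fundamentalRep (Fin 2)) ((2 : ℕ) * (βW / 4)) W supp := by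
    rw [hG]; exact Set.mem_singleton μ
  have hμG : IsGibbsMeasure (perturbedYM (d := 4) (fundamentalRep (Fin 2)) ((2 : ℕ) * (βW / 4)) W supp) μ := hμ
  haveI := hμG.isProbabilityMeasure
  refine ⟨μ, hG, fun ηs p => ?_⟩
  set Λs : ℕ → Finset (ZdEdge 4) := fun M => (box 4 M) ×ˢ (Finset.univ : Finset (Fin 4)) with hΛs
  have hcof : ∀ Δ : Finset (ZdEdge 4), ∀ᶠ n in atTop, Δ ⊆ Λs n := by
    intro Δ
    refine eventually_atTop.2 ⟨Δ.sup fun e => supNormZd e.1, fun n hn e he => ?_⟩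
    refine Finset.mem_product.2 ⟨mem_box.2 fun i => ?_, Finset.mem_univ _⟩
    have h1 : supNormZd e.1 ≤ n := (Finset.le_sup (f := fun e : ZdEdge 4 => supNormZd e.1) he).trans hn
    have h3 := natAbs_le_supNormZd e.1 i
    omega
  obtain ⟨hF, -⟩ := hlim Λs hcof
  set γ := perturbedYM (d := 4) (fundamentalRep (Fin 2)) ((2 : ℕ) * (βW / 4)) W supp with hγdef
  have hWb0 : ∀ X, ∃ C, ∀ U, |W X U| ≤ C := fun X => exists_bound_of_continuous (hW.continuous X)
  have hγspec : IsSpecification γ :=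
    isSpecification_perturbedYM _ (continuous_fundamentalRep (Fin 2)) _
      (fun X => ⟨hW.dependsOn X, (hW.continuous X).measurable⟩) hWb0 hW.supportedBy
  haveI hγprob : ∀ Λ ζ, IsProbabilityMeasure (γ Λ ζ) := fun Λ ζ => hγspec.isProbability Λ ζ
  set Wp : ZdPlaquette 4 → LGConfig 4 (SUN 2) → ℝ :=
    fun r => zdPlaquetteObs (fundamentalRep (Fin 2)) r.1 r.2.1.1 r.2.1.2 with hWp
  have hWc : ∀ r : ZdPlaquette 4, Continuous (Wp r) := fun r =>
    continuous_of_isLipschitzCylinder (isLipschitzCylinder_zdPlaquetteObs (N := 2) r.1 r.2.2)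
  have hWbd : ∀ r : ZdPlaquette 4, ∀ U, |Wp r U| ≤ 1 := fun r U =>
    abs_zdPlaquetteObs_le fundamentalRep_mem_unitaryGroup r.1 r.2.1.1 r.2.1.2 U
  have hWmem : ∀ (r : ZdPlaquette 4) (ν : Measure (LGConfig 4 (SUN 2))) [IsProbabilityMeasure ν], MemLp (Wp r) 2 ν :=
    fun r ν _ => memLp_of_bounded (a := -1) (b := 1)
      (ae_of_all _ fun U => by simp only [Set.mem_Icc]; exact abs_le.1 (hWbd r U)) (hWc r).measurable.aestronglyMeasurable 2
  have hcovlim : ∀ q : ZdPlaquette 4, Tendsto (fun n => cov[Wp p, Wp q; γ (Λs n) (ηs n)]) atTop (𝓝 (cov[Wp p, Wp q; μ])) := by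
    intro q
    have h1 := hF ηs (fun U => Wp p U * Wp q U) ((hWc p).mul (hWc q))
      ⟨1, fun U => by rw [abs_mul]; exact mul_le_one₀ (hWbd p U) (abs_nonneg _) (hWbd q U)⟩
    have h2 := hF ηs (Wp p) (hWc p) ⟨1, hWbd p⟩
    have h3 := hF ηs (Wp q) (hWc q) ⟨1, hWbd q⟩
    have hcovn : ∀ n, cov[Wp p, Wp q; γ (Λs n) (ηs n)] =
        (∫ U, Wp p U * Wp q U ∂(γ (Λs n) (ηs n))) - (∫ U, Wp p U ∂(γ (Λs n) (ηs n))) * ∫ U, Wp q U ∂(γ (Λs n) (ηs n)) :=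
      fun n => covariance_eq_sub (hWmem p _) (hWmem q _)
    have hcovμ : cov[Wp p, Wp q; μ] = (∫ U, Wp p U * Wp q U ∂μ) - (∫ U, Wp p U ∂μ) * ∫ U, Wp q U ∂μ :=
      covariance_eq_sub (hWmem p _) (hWmem q _)
    simp_rw [hcovn, hcovμ]
    exact h1.sub (h2.mul h3)
  set S : ℕ → Finset (ZdPlaquette 4) := fun M => (box 4 M) ×ˢ (Finset.univ : Finset {o : Fin 4 × Fin 4 // o.1 < o.2}) with hS
  have hSmem : ∀ q : ZdPlaquette 4, ∀ᶠ M in atTop, q ∈ S M := by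
    intro q
    refine eventually_atTop.2 ⟨supNormZd q.1, fun M hM => ?_⟩
    refine Finset.mem_product.2 ⟨mem_box.2 fun i => ?_, Finset.mem_univ _⟩
    have h3 := natAbs_le_supNormZd q.1 i
    omega
  have hterm : ∀ q : ZdPlaquette 4,
      Tendsto (fun M => if q ∈ S M then cov[Wp p, Wp q; γ (Λs M) (ηs M)] else 0) atTop (𝓝 (cov[Wp p, Wp q; μ])) := by
    intro q
    refine (hcovlim q).congr' ?_
    filter_upwards [hSmem q] with M hM
    rw [if_pos hM]
  -- uniform domination through the robust star door on the ball
  set P : ℕ := supNormZd p.1 with hP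
  have hp : p.1 ∈ box 4 P := mem_box.2 fun i => by have := natAbs_le_supNormZd p.1 i; omega
  set ρs : ℝ := gaugeR 4 (17651 / 200000 : ℝ) + ((16971 / 1000000 : ℝ) +
      (6 * (17651 / 200000 : ℝ) + 16971 / 1000000) ^ 20 * (16 * (16971 / 1000000 : ℝ))) /
      (1 - (6 * (17651 / 200000 : ℝ) + 16971 / 1000000)) with hρs
  have hρs1 : ρs < 1 := by rw [hρs]; unfold gaugeR StarResolventDim.Delta; norm_num
  set E : ℕ := max R 1 + 2 + 2 with hEdef
  set t : ℝ := -Real.log (max ρs (1 / 2)) with ht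
  have ht0 : 0 < t := by
    rw [ht, neg_pos]
    exact Real.log_neg (lt_max_of_lt_right (by norm_num)) (max_lt hρs1 (by norm_num))
  set C : ℝ := 262144 * Real.exp (t * ((2 * P + 2) / E + 1)) with hC
  have hC0 : 0 ≤ C := by positivity
  set r : ℝ := Real.exp (-(t / E / (4 : ℕ))) with hr
  have hr0 : 0 ≤ r := (Real.exp_pos _).le
  have hE0 : (0 : ℝ) < (E : ℝ) := by rw [hEdef]; positivity
  have hr1 : r < 1 := by
    rw [hr]
    exact Real.exp_lt_one_iff.2 (neg_neg_of_pos (by positivity))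
  have hbound : ∀ᶠ M in atTop, ∀ q : ZdPlaquette 4,
      ‖(if q ∈ S M then cov[Wp p, Wp q; γ (Λs M) (ηs M)] else 0)‖ ≤ C * r ^ l1 (p.1 - q.1) := by
    refine eventually_atTop.2 ⟨P + 1, fun M hM q => ?_⟩
    rw [Real.norm_eq_abs]
    split_ifs with hq
    · have hq1 : q.1 ∈ box 4 M := (Finset.mem_product.1 hq).1
      have hPM : P < M := by omega
      refine (su2_abs_cov_plaquette_kernel_box_ball_upTo_oneThird h0 h hW hPM (ηs M) hp hq1).trans ?_
      rw [← hρs, ← ht, ← hEdef]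
      refine mul_le_mul_of_nonneg_left ?_ hC0
      have := exp_neg_norm_le_pow (d := 4) (by norm_num) (m := t / E) (by positivity) (p.1 - q.1)
      rw [hr]
      convert this using 2
    · rw [abs_zero]; positivity
  have hsumb : Summable fun q : ZdPlaquette 4 => C * r ^ l1 (p.1 - q.1) := (summable_and_tsum_row_le (d := 4) hC0 hr0 hr1 p).1
  have hT := tendsto_tsum_of_dominated_convergence hsumb hterm hbound
  have hfin : ∀ M, ∑' q : ZdPlaquette 4, (if q ∈ S M then cov[Wp p, Wp q; γ (Λs M) (ηs M)] else 0) =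
      ∑ q ∈ S M, cov[Wp p, Wp q; γ (Λs M) (ηs M)] := by
    intro M
    rw [tsum_eq_sum (s := S M) (fun q hq => if_neg hq)]
    exact Finset.sum_congr rfl fun q hq => if_pos hq
  refine ⟨?_, hT.congr fun M => hfin M⟩
  refine Summable.of_norm_bounded hsumb fun q => ?_
  rw [Real.norm_eq_abs]
  refine le_of_tendsto ((hterm q).abs) ?_
  filter_upwards [hbound] with M hM
  have := hM q
  rwa [Real.norm_eq_abs] at this

end Summit.Ventures.YMGap.RobustBall

end
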